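import Summits.QuantumFields.BalabanUV.T4Continuum.Support.B13KPStepOfRecord
import Summits.QuantumFields.BalabanUV.T4Continuum.Support.B13StepOfRecordTermData

/-!
# NE5 ∕ U3, route P2 — L07 DISCHARGED ON THE OBJECTS OF RECORD: the term family of record (leaf-08's (2.14)-term data
# `B13TermData.termData` on the KP-form step model of record), its `BaseMajorant` ∕ `ActivityLipschitz₂` as THEOREMS of
# per-term one-run data, and route P2's END on Bałaban's carriers with NO activity-level binder left

Cell `pub-balaban`, unit `b2b-balaban-t4-ne5-p2` (T⁴ fan-out NE5 ∕ node U3, PROVER seat P2 «polymer-activity Lipschitz ∕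
Kotecký–Preiss route», lineage gen 19).  Summits-side new work under the LEAN PLACEMENT RULE (cell bookkeeping over the swarm's
objects of record; NOT a Literature module; nothing of the manuscripts under audit is asserted).  HONEST FRAMING: rung (B)+1 of the
FINITE-VOLUME T⁴ continuum programme — NOT infinite volume, NOT a mass gap, NOT the Clay problem, and **NOT A PROOF OF NE5** (spine
0∕9): the END below is an IMPLICATION whose analytic binders are DISPLAYED.  HONEST DEPENDENCY (cell line, verbatim): continuum YM
on T⁴ ⇐ BetaPertH ∧ nine spine estimates (0/9 proved); BetaPertH ⇐ (D1) ∧ (D4) ∧ CAP+tail; G-an2-4 gates asym, D1 and NE2/3/4.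

WHY.  Gen 18's END-L on the objects of record (`B13KPStepOfRecord.ne5_above_max_kp_record`) displays, for the ACTIVITIES OF RECORD
`actOf S X q Z = Σ_{ℓ ∈ innerLabels k Z} S.act Z ℓ q.1 q.2`, the activity majorant `BaseMajorant` and the two-species activity modulus
`ActivityLipschitz₂` (leaf L07 of `t4/skeletons/NE5-t4-ne5-p2.md`) as BINDERS, because the slot `S.act` of `B13StepOfRecord.Slots` is an
arbitrary functional.  Leaf-08's `B13StepOfRecordTermData.TermSlots.toSlots` (p212552) puts that slot in (2.14)-TERM FORMAT:
`act := actOf (termData F G rHist core)`, i.e. `act Z ℓ o h = ((core Z ℓ).toTermDatum …).term (o, h)` with route P2's `TermDatum.term`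
(`ActivityTermDatum`, p195577).  For such slots L07 is a THEOREM of per-term one-run data (K6 `ActivityTermModel.activityLipschitz₂_model`
∕ `baseMajorant_model`: admissible constants, one-run geometry, read-out Lipschitz structure, reference data at the base point, and the
per-term majorants summing under `m`) — this file performs that discharge ON THE CARRIERS OF RECORD.

WHAT.  For `𝔖 : TermSlots R P dom T κ ι S Ω Ω₀ 𝒞 IOp`, levels `E₀ cB` and ONE family of term constants `𝔡 Z ℓ : TermConsts` per polymer
and inner label (leaf-08's indexing; uniform in the run, the coupling and the background — the printed KIND):
* §1 two generic TRANSFER lemmas for `InputModel`s with the same activities and margins and NESTED admissible classes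
  (`baseMajorant_of_subset`, `activityLipschitz₂_of_subset`);
* §2 **`termFamily 𝔖 E₀ cB 𝔡`** — route P2's `TermFamily` OF RECORD over `clusterRep R (rhoA 𝔖.toSlots E₀ cB) (rhoB 𝔖.toSlots E₀ cB)`:
  terms of `Z` at a step-`k` output domain = the inner catalogue `innerLabels (b13InnerData R) k Z`, term data = leaf-08's
  `termData 𝔖.F 𝔖.G 𝔖.rHist 𝔖.core`, inputs and margins READ from the step of record; `model_Ψ_eq` (its activities ARE the activities
  of record of `B13KPStepOfRecord.inputModel 𝔖.toSlots E₀ cB`, `rfl`), `readsStep_termFamily`, `realizes_termFamily` (L02, no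
  hypothesis), `mem_base_iff` (its admissible class = «reference data `RefAt` for every term of every step-`k` polymer»), `inBase_termFamily`
  (L06 = `RefAt` at run B's OWN input point of record `inputB_KP`); `wellFormed_of_pointwise` (adapter: leaf-08's per-(Z, ℓ) section binders
  `hadm`∕`hgeo`∕`hlip` of `B13TermDataOpSecant`, read on the catalogued labels ⟹ `WellFormed`);
* §3 THE PRODUCERS: **`baseMajorant_kp_of_termData`** ∕ **`activityLipschitz₂_kp_of_termData`** — `(inputModel 𝔖.toSlots E₀ cB).BaseMajorant W m`
  and `.ActivityLipschitz₂ W m Λop Λhist ρ₀` (the two L07 binders of gen 18's END, in the HOLDER's admissible class) from the term family's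
  well-formedness, `Σ_ℓ G_ℓ ≤ m`, `0 < Λop, Λhist`, `ρ₀ ≤ 1` and ONE displayed inclusion «the holder's budget-box class carries `RefAt` for
  every term» (L06 on the class); hence **`ne5_above_max_kp_record_of_termData`** = gen 18's END with `hmaj`∕`hlip` DISCHARGED;
* §4 **`ne5_above_max_kp_termModel`** — route P2's END-T (`ActivityStepJunction.TermFamily.ne5_above_max_of_model_reach_step`) ON THE
  OBJECTS OF RECORD with route P2's OWN admissible class: MI-R DISCHARGED (`represents_kp`, `realizes_termFamily`, `readsStep_termFamily`),
  L07 DISCHARGED (inside K6), L08a∕L08b PROVED, L03 = `kpInflated_b13`; DISPLAYED: L03's (2.38)-shaped majorant + two inequalities,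
  L04∕L05 (`WellFormed`: admissible constants, one-run geometry, read-out Lipschitz structure of every term of record), `hsum`, L06
  (`RefAt` at run B's input point of record), the levels, W1∕W4∕W3 in the holder's currency, numerics; conclusion
  `∃ C₅, NE5 (outA_KP 𝔖.toSlots E₀ cB) (outB_KP 𝔖.toSlots E₀ cB) W κ θ′ C₅`; **`ne5_at_rate_kp_termModel`**: AT the input rate `θ` itself under
  the one extra inequality `r_fb < θ` (off resonance, `max θ r_fb = θ`); and **`ne5_above_max_record_termModel`**: the same for the
  holder's `(outA, outB)` of record by R-IDENT (`B13KPStepOfRecord.ne5_above_max_record_of_kp`).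
HONEST RESIDUE.  The term CORES and CONSTANTS are NAMED PARAMETERS (leaf-08's caveat: not the owner's «O1-d2-ii act instance»); every
analytic input is displayed; W1 = rows NE2 ∧ NE3, W3, W4, the levels and the numerics are untouched; `FlowStep.BetaPertH`, (B), (B^μ) do
not occur.  0 sorry; axioms ⊆ {propext, Classical.choice, Quot.sound}.
-/

noncomputable section

open MeasureTheory
open scoped BigOperators

namespace Summit.QuantumFields.BalabanUV.T4Continuum.B13KPStepTermModel

open Literature.MathematicalPhysics.QuantumFieldTheory.Balaban1983to89
open Literature.MathematicalPhysics.QuantumFieldTheory.Balaban1983to89.T4OutputRate (Carriers Functional DecayBound NE5)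
open Literature.MathematicalPhysics.QuantumFieldTheory.Balaban1983to89.T4InputCauchyRateData (StepModel tableA tableB)
open Literature.MathematicalPhysics.QuantumFieldTheory.Balaban1983to89.T4ActivityLipschitz (ClusterRep)
open Literature.MathematicalPhysics.QuantumFieldTheory.Balaban1983to89.T4ActivityRecursion (InputModel KPInflated relDisc)
open Summit.QuantumFields.BalabanUV.T4Continuum.ActivityTermModel (TermDatum TermConsts TermFamily)
open Summit.QuantumFields.BalabanUV.T4Continuum.ActivityStepJunction (ReadsStep)
open Summit.QuantumFields.BalabanUV.T4Continuum.B13Carriers (TwoRuns)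
open Summit.QuantumFields.BalabanUV.T4Continuum.ClusterRepOfDomains (DomainGeometry)
open Summit.QuantumFields.BalabanUV.T4Continuum.B13DomainGeometryTR (domainGeometry clusterRep decayExtract_b13 pinBudget_b13
  kpInflated_b13)
open Summit.QuantumFields.BalabanUV.T4Continuum.B13InnerData (b13InnerData Bnd)
open Summit.QuantumFields.BalabanUV.T4Continuum.B13OpDatum (OpDatum Species)
open Summit.QuantumFields.BalabanUV.T4Continuum.B13HistMeasurable (MeasPotFrame B13HistM)
open Summit.QuantumFields.BalabanUV.T4Continuum.B13StepOfRecord (Slots step outA outB assembly structure_binders)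
open Summit.QuantumFields.BalabanUV.T4Continuum.B13StepTermLabels (InnerLabel innerLabels)
open Summit.QuantumFields.BalabanUV.T4Continuum.B13OutKPForm (activity)
open Summit.QuantumFields.BalabanUV.T4Continuum.B13OutKPFormRecord (actOf LevelSummable ClusAbsConv)
open Summit.QuantumFields.BalabanUV.T4Continuum.B13KPStepOfRecord (outA_KP outB_KP rhoA rhoB inputModel inputA_KP inputB_KP
  represents_kp realizes_kp readsStep_kp ne5_above_max_kp_record ne5_above_max_record_of_kp)
open Summit.QuantumFields.BalabanUV.T4Continuum.B13TermData (TermCore termData)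
open Summit.QuantumFields.BalabanUV.T4Continuum.B13StepOfRecordTermData (TermSlots)

/-! ## §1 Transfer of the two L07 shapes between input models with the same activities and nested admissible classes -/

section Transfer

variable {C : Carriers} {Rc : ClusterRep C} {Op Hist : Type*} [NormedAddCommGroup Op] [NormedSpace ℂ Op]
  [NormedAddCommGroup Hist] [NormedSpace ℂ Hist] (M M' : InputModel Rc Op Hist)

/-- [folklore] (bookkeeping) `BaseMajorant` transfers from `M'` to `M`: same activities, `M`'s admissible class inside `M'`'s. -/
theorem baseMajorant_of_subset {W : Set (ℕ → ℝ)} {m : (ℕ → ℝ) → C.BgB → Rc.P → ℝ}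
    (hΨ : ∀ (g : ℕ → ℝ) (U : C.BgB) (X : C.Dom) (γ : Rc.P) (q : Op × Hist), M.Ψ g U X γ q = M'.Ψ g U X γ q)
    (hB : ∀ g ∈ W, ∀ (U : C.BgB) (X : C.Dom), M.Base g U X ⊆ M'.Base g U X) (h : M'.BaseMajorant W m) :
    M.BaseMajorant W m := by
  intro g hg U X p hp γ hγ
  rw [hΨ]
  exact h g hg U X p (hB g hg U X hp) γ hγ

/-- [folklore] (bookkeeping) `ActivityLipschitz₂` transfers from `M'` to `M`: same activities and margins, nested admissible classes. -/
theorem activityLipschitz₂_of_subset {W : Set (ℕ → ℝ)} {m : (ℕ → ℝ) → C.BgB → Rc.P → ℝ} {Λop Λhist ρ₀ : ℝ}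
    (hΨ : ∀ (g : ℕ → ℝ) (U : C.BgB) (X : C.Dom) (γ : Rc.P) (q : Op × Hist), M.Ψ g U X γ q = M'.Ψ g U X γ q)
    (hOp : ∀ X : C.Dom, M.ϱOp X = M'.ϱOp X) (hHist : ∀ X : C.Dom, M.ϱHist X = M'.ϱHist X)
    (hB : ∀ g ∈ W, ∀ (U : C.BgB) (X : C.Dom), M.Base g U X ⊆ M'.Base g U X)
    (h : M'.ActivityLipschitz₂ W m Λop Λhist ρ₀) : M.ActivityLipschitz₂ W m Λop Λhist ρ₀ := by
  intro g hg U X p hp q hq γ hγ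
  rw [hΨ, hΨ, hOp, hHist]
  rw [hOp, hHist] at hq
  exact h g hg U X p (hB g hg U X hp) q hq γ hγ

end Transfer

/-! ## §2 The term family of record -/

section Record

variable {𝔾 : Type} [GaugeGroup 𝔾] {R : TwoRuns 𝔾} {P : MeasPotFrame R.carriers} {𝒴 : Type*} {dom : 𝒴 → R.carriers.Dom}
  {T κ ι S Ω Ω₀ 𝒞 IOp : Type*} [MeasurableSpace Ω] [MeasurableSpace Ω₀] [Fintype ι] [Fintype κ] [DecidableEq ι] [DecidableEq κ]
  (𝔖 : TermSlots R P dom T κ ι S Ω Ω₀ 𝒞 IOp) (E₀ cB : ℝ)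
  (𝔡 : R.carriers.Dom → InnerLabel R.carriers.Dom (Bnd R) → TermConsts)

/-- [folklore] **ROUTE P2's TERM FAMILY OF RECORD**: at a step-`k` output domain `X`, the terms of the activity of the polymer `Z` are
its inner labels `ℓ ∈ innerLabels (b13InnerData R) k Z` ((2.9)∕(2.1)∕(2.3) of [Balaban1988RG2Cluster] summed — the catalogue of record),
the datum of the term `(Z, ℓ)` is leaf-08's `termData 𝔖.F 𝔖.G 𝔖.rHist 𝔖.core Z ℓ` (route P2's (2.14)-format with the read-outs of
record), its constants are `𝔡 Z ℓ` (NAMED PARAMETERS), the two runs' inputs and the margins are those of the step of record at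
`k = scale X`. -/
def termFamily : TermFamily (clusterRep R (rhoA 𝔖.toSlots E₀ cB) (rhoB 𝔖.toSlots E₀ cB)) (OpDatum (Species T κ ι Ω 𝒴))
    (B13HistM P) ι κ S Ω Ω₀ 𝒴 𝒞 (InnerLabel R.carriers.Dom (Bnd R)) where
  terms _ _ X Z := innerLabels (b13InnerData R) (R.carriers.scale X) Z
  𝔱 _ _ _ Z ℓ := termData 𝔖.F 𝔖.G 𝔖.rHist 𝔖.core Z ℓ
  𝔠 _ _ _ Z ℓ := 𝔡 Z ℓ
  opA g U X := (step 𝔖.toSlots E₀ cB).opA g U (R.carriers.scale X)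
  opB g U X := (step 𝔖.toSlots E₀ cB).opB g U (R.carriers.scale X)
  insA g U X := (step 𝔖.toSlots E₀ cB).insA g U (R.carriers.scale X)
  insB g U X := (step 𝔖.toSlots E₀ cB).insB g U (R.carriers.scale X)
  ϱOp X := 𝔖.rOp (R.carriers.scale X)
  ϱHist X := 𝔖.rHist (R.carriers.scale X)
  ϱOp_pos _ := 𝔖.rOp_pos _
  ϱHist_pos _ := 𝔖.rHist_pos _

/-- [folklore] **THE TERM MODEL's ACTIVITIES ARE THE ACTIVITIES OF RECORD** of route P2's input model of record (`rfl`). -/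
theorem model_Ψ_eq (g : ℕ → ℝ) (U : R.carriers.BgB) (X Z : R.carriers.Dom) (q : OpDatum (Species T κ ι Ω 𝒴) × B13HistM P) :
    (inputModel 𝔖.toSlots E₀ cB).Ψ g U X Z q = (termFamily 𝔖 E₀ cB 𝔡).model.Ψ g U X Z q := rfl

/-- [folklore] The margins of the term model are those of the input model of record (`rfl`). -/
theorem model_ϱOp_eq (X : R.carriers.Dom) : (inputModel 𝔖.toSlots E₀ cB).ϱOp X = (termFamily 𝔖 E₀ cB 𝔡).model.ϱOp X := rfl
/-- [folklore] -/
theorem model_ϱHist_eq (X : R.carriers.Dom) : (inputModel 𝔖.toSlots E₀ cB).ϱHist X = (termFamily 𝔖 E₀ cB 𝔡).model.ϱHist X := rfl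

/-- [folklore] **`ReadsStep` FOR THE TERM FAMILY OF RECORD** against the step of record (six `rfl`s): the holder's W1∕W3∕W4 binders
feed it verbatim. -/
theorem readsStep_termFamily : ReadsStep (termFamily 𝔖 E₀ cB 𝔡).model (step 𝔖.toSlots E₀ cB) :=
  ActivityStepJunction.TermFamily.readsStep_model (termFamily 𝔖 E₀ cB 𝔡) (fun _ _ _ => rfl) (fun _ _ _ => rfl)
    (fun _ _ _ _ => rfl) (fun _ _ _ _ => rfl) (fun _ => rfl) fun _ => rfl

/-- [folklore] **L02 FOR THE TERM FAMILY OF RECORD, hypothesis-free**: `Realizes` for the KP recursion's outputs (the term model's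
activities and input points ARE those of the input model of record, for which this is `B13KPStepOfRecord.realizes_kp`). -/
theorem realizes_termFamily (W : Set (ℕ → ℝ)) :
    (termFamily 𝔖 E₀ cB 𝔡).model.Realizes (outA_KP 𝔖.toSlots E₀ cB) (outB_KP 𝔖.toSlots E₀ cB) W :=
  realizes_kp 𝔖.toSlots E₀ cB W

/-- [folklore] **THE ADMISSIBLE CLASS OF THE TERM MODEL OF RECORD** at a step-`k` output domain `X`: the input points carrying route P2's
one-run reference data `RefAt` for EVERY term `(Z, ℓ)` of EVERY step-`k` polymer `Z` (printed KIND for one run: [II] (2.15)–(2.26)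
pp. 15–18; asserted for nothing). -/
theorem mem_base_iff {g : ℕ → ℝ} {U : R.carriers.BgB} {X : R.carriers.Dom} {q : OpDatum (Species T κ ι Ω 𝒴) × B13HistM P} :
    q ∈ (termFamily 𝔖 E₀ cB 𝔡).model.Base g U X ↔
      ∀ Z ∈ (domainGeometry R).level (R.carriers.scale X), ∀ ℓ ∈ innerLabels (b13InnerData R) (R.carriers.scale X) Z,
        (termData 𝔖.F 𝔖.G 𝔖.rHist 𝔖.core Z ℓ).RefAt (𝔡 Z ℓ) q :=
  Iff.rfl

/-- [folklore] **L06 FOR THE TERM FAMILY OF RECORD**: `InBase` for the KP recursion's run-B output IS «reference data for every term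
of record at run B's OWN input point of record `inputB_KP`» — displayed, printed KIND for one run. -/
theorem inBase_termFamily {W : Set (ℕ → ℝ)}
    (hRef : ∀ g ∈ W, ∀ (U : R.carriers.BgB) (X : R.carriers.Dom),
      ∀ Z ∈ (domainGeometry R).level (R.carriers.scale X), ∀ ℓ ∈ innerLabels (b13InnerData R) (R.carriers.scale X) Z,
        (termData 𝔖.F 𝔖.G 𝔖.rHist 𝔖.core Z ℓ).RefAt (𝔡 Z ℓ) (inputB_KP 𝔖.toSlots E₀ cB g U X)) :
    (termFamily 𝔖 E₀ cB 𝔡).model.InBase (outB_KP 𝔖.toSlots E₀ cB) W :=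
  fun g hg U X => hRef g hg U X

/-! ## §3 The producers: `BaseMajorant` and `ActivityLipschitz₂` of the activities of record from per-term one-run data -/

variable [DecidableEq 𝒞]

/-- [folklore] **ADAPTER TO PER-TERM BINDERS** (the section binders `hadm`∕`hgeo`∕`hlip` of leaf-08's `B13TermDataOpSecant`, read on the
catalogued labels): admissible constants, route P2's one-run `Geometry` and `ReadLip` at the margins OF THE POLYMER's OWN SCALE, for every
well-formed label of every catalogued polymer, make the term family of record well formed on any window. -/
theorem wellFormed_of_pointwise (W : Set (ℕ → ℝ))
    (hadm : ∀ k, ∀ Z ∈ (domainGeometry R).level k, ∀ ℓ ∈ innerLabels (b13InnerData R) k Z, (𝔡 Z ℓ).Admissible)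
    (hgeo : ∀ k, ∀ Z ∈ (domainGeometry R).level k, ∀ ℓ ∈ innerLabels (b13InnerData R) k Z,
      (termData 𝔖.F 𝔖.G 𝔖.rHist 𝔖.core Z ℓ).Geometry (𝔡 Z ℓ))
    (hlip : ∀ k, ∀ Z ∈ (domainGeometry R).level k, ∀ ℓ ∈ innerLabels (b13InnerData R) k Z,
      (termData 𝔖.F 𝔖.G 𝔖.rHist 𝔖.core Z ℓ).ReadLip (𝔡 Z ℓ) (𝔖.rOp (R.carriers.scale Z)) (𝔖.rHist (R.carriers.scale Z))) :
    (termFamily 𝔖 E₀ cB 𝔡).WellFormed W where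
  hadm _ _ _ X Z hZ ℓ hℓ := hadm (R.carriers.scale X) Z hZ ℓ hℓ
  hgeo _ _ _ X Z hZ ℓ hℓ := hgeo (R.carriers.scale X) Z hZ ℓ hℓ
  hlip _ _ _ X Z hZ ℓ hℓ := by
    have hsc : R.carriers.scale Z = R.carriers.scale X := ((domainGeometry R).mem_level Z _).1 hZ
    have h := hlip (R.carriers.scale X) Z hZ ℓ hℓ
    rw [hsc] at h
    exact h

/-- [folklore] The same from leaf-08's UNRESTRICTED per-(Z, ℓ) section binders (`B13TermDataOpSecant` §2, verbatim shapes). -/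
theorem wellFormed_of_forall (W : Set (ℕ → ℝ)) (hadm : ∀ Z ℓ, (𝔡 Z ℓ).Admissible)
    (hgeo : ∀ Z ℓ, (termData 𝔖.F 𝔖.G 𝔖.rHist 𝔖.core Z ℓ).Geometry (𝔡 Z ℓ))
    (hlip : ∀ Z ℓ, (termData 𝔖.F 𝔖.G 𝔖.rHist 𝔖.core Z ℓ).ReadLip (𝔡 Z ℓ) (𝔖.rOp (R.carriers.scale Z)) (𝔖.rHist (R.carriers.scale Z))) :
    (termFamily 𝔖 E₀ cB 𝔡).WellFormed W :=
  wellFormed_of_pointwise 𝔖 E₀ cB 𝔡 W (fun _ Z _ ℓ _ => hadm Z ℓ) (fun _ Z _ ℓ _ => hgeo Z ℓ) fun _ Z _ ℓ _ => hlip Z ℓ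

/-- [folklore] **L07 (majorant half) FOR THE ACTIVITIES OF RECORD IN THE HOLDER's CLASS.**  If the term family of record is well formed
on the window (L04∕L05), the per-term majorants `G = size + ampOp∕Λop + ampHist∕Λhist` sum under `m` (L03-dom), and every point of the
holder's admissible class at step `k` carries reference data for every term of every step-`k` polymer (L06 on the class), then
`(inputModel 𝔖.toSlots E₀ cB).BaseMajorant W m` — the `hmaj` binder of `B13KPStepOfRecord.ne5_above_max_kp_record`, PRODUCED. -/
theorem baseMajorant_kp_of_termData {W : Set (ℕ → ℝ)} {m : (ℕ → ℝ) → R.carriers.BgB → R.carriers.Dom → ℝ} {Λop Λhist ρ₀ : ℝ}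
    (hwf : (termFamily 𝔖 E₀ cB 𝔡).WellFormed W) (hΛop : 0 < Λop) (hΛhist : 0 < Λhist)
    (hsum : ∀ g ∈ W, ∀ (U : R.carriers.BgB) (X : R.carriers.Dom), ∀ Z ∈ (domainGeometry R).level (R.carriers.scale X),
      ∑ ℓ ∈ innerLabels (b13InnerData R) (R.carriers.scale X) Z, (termFamily 𝔖 E₀ cB 𝔡).G Λop Λhist ρ₀ g U X Z ℓ ≤ m g U Z)
    (hcls : ∀ g ∈ W, ∀ (U : R.carriers.BgB) (X : R.carriers.Dom), ∀ q ∈ (step 𝔖.toSlots E₀ cB).Base (R.carriers.scale X) g U,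
      ∀ Z ∈ (domainGeometry R).level (R.carriers.scale X), ∀ ℓ ∈ innerLabels (b13InnerData R) (R.carriers.scale X) Z,
        (termData 𝔖.F 𝔖.G 𝔖.rHist 𝔖.core Z ℓ).RefAt (𝔡 Z ℓ) q) :
    (inputModel 𝔖.toSlots E₀ cB).BaseMajorant W m :=
  baseMajorant_of_subset _ _ (model_Ψ_eq 𝔖 E₀ cB 𝔡) (fun g hg U X q hq => hcls g hg U X q hq)
    ((termFamily 𝔖 E₀ cB 𝔡).baseMajorant_model hwf hΛop hΛhist hsum)

/-- [folklore] **L07 (modulus half) FOR THE ACTIVITIES OF RECORD IN THE HOLDER's CLASS.**  Same data plus the reach `ρ₀ ≤ 1`: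
`(inputModel 𝔖.toSlots E₀ cB).ActivityLipschitz₂ W m Λop Λhist ρ₀` — the `hlip` binder of gen 18's END, PRODUCED (K6's tilt ∕ Neumann ∕
Schur bounds per term; nothing assumed at the displaced point; NO analyticity). -/
theorem activityLipschitz₂_kp_of_termData {W : Set (ℕ → ℝ)} {m : (ℕ → ℝ) → R.carriers.BgB → R.carriers.Dom → ℝ}
    {Λop Λhist ρ₀ : ℝ} (hwf : (termFamily 𝔖 E₀ cB 𝔡).WellFormed W) (hΛop : 0 < Λop) (hΛhist : 0 < Λhist) (hρ₁ : ρ₀ ≤ 1)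
    (hsum : ∀ g ∈ W, ∀ (U : R.carriers.BgB) (X : R.carriers.Dom), ∀ Z ∈ (domainGeometry R).level (R.carriers.scale X),
      ∑ ℓ ∈ innerLabels (b13InnerData R) (R.carriers.scale X) Z, (termFamily 𝔖 E₀ cB 𝔡).G Λop Λhist ρ₀ g U X Z ℓ ≤ m g U Z)
    (hcls : ∀ g ∈ W, ∀ (U : R.carriers.BgB) (X : R.carriers.Dom), ∀ q ∈ (step 𝔖.toSlots E₀ cB).Base (R.carriers.scale X) g U,
      ∀ Z ∈ (domainGeometry R).level (R.carriers.scale X), ∀ ℓ ∈ innerLabels (b13InnerData R) (R.carriers.scale X) Z,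
        (termData 𝔖.F 𝔖.G 𝔖.rHist 𝔖.core Z ℓ).RefAt (𝔡 Z ℓ) q) :
    (inputModel 𝔖.toSlots E₀ cB).ActivityLipschitz₂ W m Λop Λhist ρ₀ :=
  activityLipschitz₂_of_subset _ _ (model_Ψ_eq 𝔖 E₀ cB 𝔡) (model_ϱOp_eq 𝔖 E₀ cB 𝔡) (model_ϱHist_eq 𝔖 E₀ cB 𝔡)
    (fun g hg U X q hq => hcls g hg U X q hq) ((termFamily 𝔖 E₀ cB 𝔡).activityLipschitz₂_model hwf hΛop hΛhist hρ₁ hsum)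

/-- [folklore] **GEN 18's END-L ON THE OBJECTS OF RECORD WITH L07 DISCHARGED** (`B13KPStepOfRecord.ne5_above_max_kp_record` with `hmaj` ∕
`hlip` produced by §3): displayed instead — the term family's well-formedness (L04∕L05), `hsum` (L03-dom), reference data on the holder's
class (L06 on the class), `ρ₀ ≤ 1`; every other binder verbatim (L03 letters, base membership, levels, W1∕W4∕W3 in the holder's currency,
numerics).  NOT a proof of NE5. -/
theorem ne5_above_max_kp_record_of_termData (hT : (assembly 𝔖.toSlots).TransportReads Set.univ) {W : Set (ℕ → ℝ)}
    {m : (ℕ → ℝ) → R.carriers.BgB → R.carriers.Dom → ℝ}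
    {A_m R_m τ σ s A₀ E₀' E₁ κ θ δ δ' c ω Λop Λhist ρ₀ ρ₀' : ℝ}
    -- L03 in letters: the (2.38)-shaped majorant and the two explicit inequalities
    (hA_m : 0 ≤ A_m) (hτ : 0 ≤ τ) (hσ : 0 ≤ σ) (hs0 : 0 ≤ s)
    (hm0 : ∀ (g : ℕ → ℝ) (U : R.carriers.BgB) (Z : R.carriers.Dom), 0 ≤ m g U Z)
    (hm : ∀ g ∈ W, ∀ (U : R.carriers.BgB) (k : ℕ), ∀ Z ∈ R.domAt k, m g U Z ≤ A_m * Real.exp (-(R_m * R.carriers.d Z)))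
    (hrate : 64 * Real.log 162 + σ + τ * 64 ≤ R_m)
    (hsmall : (1 + s) * A_m * Real.exp (σ * 5 + τ * 64) * B12TreeDecay.K₀ (4 * 2 ^ 4) (2 * 4) * 9 ≤ τ) (hσκ : κ + 1 ≤ σ)
    -- L04∕L05: the term family of record is well formed; L03-dom: the per-term majorants sum under `m`
    (hwf : (termFamily 𝔖 E₀ cB 𝔡).WellFormed W)
    (hsum : ∀ g ∈ W, ∀ (U : R.carriers.BgB) (X : R.carriers.Dom), ∀ Z ∈ (domainGeometry R).level (R.carriers.scale X),
      ∑ ℓ ∈ innerLabels (b13InnerData R) (R.carriers.scale X) Z, (termFamily 𝔖 E₀ cB 𝔡).G Λop Λhist ρ₀ g U X Z ℓ ≤ m g U Z)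
    (hρ₁ : ρ₀ ≤ 1)
    -- L06: base membership of run B's point (holder) and reference data on the holder's class
    (hbase : (step 𝔖.toSlots E₀ cB).InBase (outB_KP 𝔖.toSlots E₀ cB) W)
    (hcls : ∀ g ∈ W, ∀ (U : R.carriers.BgB) (X : R.carriers.Dom), ∀ q ∈ (step 𝔖.toSlots E₀ cB).Base (R.carriers.scale X) g U,
      ∀ Z ∈ (domainGeometry R).level (R.carriers.scale X), ∀ ℓ ∈ innerLabels (b13InnerData R) (R.carriers.scale X) Z,
        (termData 𝔖.F 𝔖.G 𝔖.rHist 𝔖.core Z ℓ).RefAt (𝔡 Z ℓ) q)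
    -- levels, W1, W4, W3 in the holder's currency
    (hdA : DecayBound (outA_KP 𝔖.toSlots E₀ cB) W A₀ κ) (hdB : DecayBound (outB_KP 𝔖.toSlots E₀ cB) W E₀' κ)
    (hop : (step 𝔖.toSlots E₀ cB).OperatorRate W δ θ) (hins : (step 𝔖.toSlots E₀ cB).InsertionRate W κ E₀' δ' θ)
    (hunit : (step 𝔖.toSlots E₀ cB).InsScaleBound W κ E₁ c ω)
    -- numerics
    (hE₁ : 0 < E₁) (hΛop : 0 < Λop) (hΛhist : 0 < Λhist) (hρ : max (Λhist / Λop) 1 * ρ₀' ≤ ρ₀)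
    (hs : Λhist * ρ₀' < s) (hδ : 0 ≤ δ) (hδ' : 0 ≤ δ') (hθ : 0 ≤ θ) (hθ1 : θ < 1)
    (hc : 0 ≤ c) (hω : 0 < ω) (hω1 : ω < 1) (hreach : c * (A₀ + E₀') / (1 - ω) < ρ₀')
    {θ' : ℝ} (hθ' : max θ (ω + (τ * 64 * Real.exp (-(σ * 5))) * Λhist / (s - Λhist * ρ₀') * c) < θ') :
    ∃ C₅, NE5 (outA_KP 𝔖.toSlots E₀ cB) (outB_KP 𝔖.toSlots E₀ cB) W κ θ' C₅ :=
  ne5_above_max_kp_record 𝔖.toSlots E₀ cB hT hA_m hτ hσ hs0 hm0 hm hrate hsmall hσκ hbase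
    (baseMajorant_kp_of_termData 𝔖 E₀ cB 𝔡 hwf hΛop hΛhist hsum hcls)
    (activityLipschitz₂_kp_of_termData 𝔖 E₀ cB 𝔡 hwf hΛop hΛhist hρ₁ hsum hcls)
    hdA hdB hop hins hunit hE₁ hΛop hΛhist hρ hs hδ hδ' hθ hθ1 hc hω hω1 hreach hθ'

/-! ## §4 Route P2's END-T on the objects of record, in route P2's own admissible class -/

/-- [folklore] **ROUTE P2's END ON BAŁABAN's CARRIERS OF RECORD WITH NO ACTIVITY-LEVEL BINDER** (`ActivityStepJunction.TermFamily.
ne5_above_max_of_model_reach_step` for the term family of record reading the step of record).  DISCHARGED: MI-R (`represents_kp` under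
the holder's transport reading, `realizes_termFamily`, `readsStep_termFamily`), L07 (`activityLipschitz₂_model` ∕ `baseMajorant_model`
inside), L08a∕L08b (`decayExtract_b13` ∕ `pinBudget_b13`), L03's geometry (`kpInflated_b13`), the insertion structure (holder's
`structure_binders`).  DISPLAYED: L03's (2.38)-shaped majorant `m ≤ A_m·e^{−R_m·d}` on every 𝐃_k with `64·log 162 + σ + 64τ ≤ R_m`,
`(1+s)·A_m·e^{5σ+64τ}·K₀(64,8)·9 ≤ τ`, `κ + 1 ≤ σ`; L04∕L05 = `WellFormed` (admissible constants, one-run geometry, read-out Lipschitz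
structure at the margins of record — every term of record); L03-dom `hsum`; L06 = `RefAt` of every term of record at run B's OWN input
point of record; the levels L09; W1 `OperatorRate`, W4 `InsertionRate`, W3 `InsScaleBound` of the step of record (rows NE2 ∧ NE3 ∕ the
holder's producers); numerics (R1)–(R3) and the rate clause.  Conclusion `∃ C₅, NE5 (outA_KP 𝔖.toSlots E₀ cB) (outB_KP 𝔖.toSlots E₀ cB)
W κ θ′ C₅`.  NOT a proof of NE5: an implication from displayed binders; the cores and constants are named parameters. -/
theorem ne5_above_max_kp_termModel (hT : (assembly 𝔖.toSlots).TransportReads Set.univ) {W : Set (ℕ → ℝ)}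
    {m : (ℕ → ℝ) → R.carriers.BgB → R.carriers.Dom → ℝ}
    {A_m R_m τ σ s A₀ E₀' E₁ κ θ δ δ' c ω Λop Λhist ρ₀ ρ₀' : ℝ}
    -- L03 in letters: the (2.38)-shaped majorant and the two explicit inequalities
    (hA_m : 0 ≤ A_m) (hτ : 0 ≤ τ) (hσ : 0 ≤ σ) (hs0 : 0 ≤ s)
    (hm0 : ∀ (g : ℕ → ℝ) (U : R.carriers.BgB) (Z : R.carriers.Dom), 0 ≤ m g U Z)
    (hm : ∀ g ∈ W, ∀ (U : R.carriers.BgB) (k : ℕ), ∀ Z ∈ R.domAt k, m g U Z ≤ A_m * Real.exp (-(R_m * R.carriers.d Z)))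
    (hrate : 64 * Real.log 162 + σ + τ * 64 ≤ R_m)
    (hsmall : (1 + s) * A_m * Real.exp (σ * 5 + τ * 64) * B12TreeDecay.K₀ (4 * 2 ^ 4) (2 * 4) * 9 ≤ τ) (hσκ : κ + 1 ≤ σ)
    -- L04∕L05: the term family of record is well formed; L03-dom: the per-term majorants sum under `m`
    (hwf : (termFamily 𝔖 E₀ cB 𝔡).WellFormed W)
    (hsum : ∀ g ∈ W, ∀ (U : R.carriers.BgB) (X : R.carriers.Dom), ∀ Z ∈ (domainGeometry R).level (R.carriers.scale X),
      ∑ ℓ ∈ innerLabels (b13InnerData R) (R.carriers.scale X) Z, (termFamily 𝔖 E₀ cB 𝔡).G Λop Λhist ρ₀ g U X Z ℓ ≤ m g U Z)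
    (hρ₁ : ρ₀ ≤ 1)
    -- L06: reference data for every term of record at run B's own input point of record
    (hRef : ∀ g ∈ W, ∀ (U : R.carriers.BgB) (X : R.carriers.Dom),
      ∀ Z ∈ (domainGeometry R).level (R.carriers.scale X), ∀ ℓ ∈ innerLabels (b13InnerData R) (R.carriers.scale X) Z,
        (termData 𝔖.F 𝔖.G 𝔖.rHist 𝔖.core Z ℓ).RefAt (𝔡 Z ℓ) (inputB_KP 𝔖.toSlots E₀ cB g U X))
    -- levels, W1, W4, W3 in the holder's currency
    (hdA : DecayBound (outA_KP 𝔖.toSlots E₀ cB) W A₀ κ) (hdB : DecayBound (outB_KP 𝔖.toSlots E₀ cB) W E₀' κ)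
    (hop : (step 𝔖.toSlots E₀ cB).OperatorRate W δ θ) (hins : (step 𝔖.toSlots E₀ cB).InsertionRate W κ E₀' δ' θ)
    (hunit : (step 𝔖.toSlots E₀ cB).InsScaleBound W κ E₁ c ω)
    -- numerics
    (hE₁ : 0 < E₁) (hΛop : 0 < Λop) (hΛhist : 0 < Λhist) (hρ : max (Λhist / Λop) 1 * ρ₀' ≤ ρ₀)
    (hs : Λhist * ρ₀' < s) (hδ : 0 ≤ δ) (hδ' : 0 ≤ δ') (hθ : 0 ≤ θ) (hθ1 : θ < 1)
    (hc : 0 ≤ c) (hω : 0 < ω) (hω1 : ω < 1) (hreach : c * (A₀ + E₀') / (1 - ω) < ρ₀')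
    {θ' : ℝ} (hθ' : max θ (ω + (τ * 64 * Real.exp (-(σ * 5))) * Λhist / (s - Λhist * ρ₀') * c) < θ') :
    ∃ C₅, NE5 (outA_KP 𝔖.toSlots E₀ cB) (outB_KP 𝔖.toSlots E₀ cB) W κ θ' C₅ := by
  obtain ⟨haffN, hblindN, hhomN, -⟩ := structure_binders 𝔖.toSlots E₀ cB W
  exact ActivityStepJunction.TermFamily.ne5_above_max_of_model_reach_step (termFamily 𝔖 E₀ cB 𝔡)
    (readsStep_termFamily 𝔖 E₀ cB 𝔡) hwf hsum hρ₁
    (represents_kp 𝔖.toSlots E₀ cB hT) (realizes_termFamily 𝔖 E₀ cB 𝔡 W) (inBase_termFamily 𝔖 E₀ cB 𝔡 hRef)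
    (kpInflated_b13 (rhoA 𝔖.toSlots E₀ cB) (rhoB 𝔖.toSlots E₀ cB) hA_m hτ hσ hs0 hm0 hm hrate hsmall)
    (decayExtract_b13 (rhoA 𝔖.toSlots E₀ cB) (rhoB 𝔖.toSlots E₀ cB) hσ)
    (pinBudget_b13 (rhoA 𝔖.toSlots E₀ cB) (rhoB 𝔖.toSlots E₀ cB) hτ hσκ) hdA hdB hop hins haffN hblindN hhomN hunit hE₁
    (by positivity) hΛop hΛhist hρ hs hδ hδ' hθ hθ1 hc hω hω1 hreach hθ'

/-- [folklore] **… AT THE INPUT RATE `θ` ITSELF WHEN THE HISTORY-FEEDBACK THRESHOLD IS BELOW IT** (K7's off-resonance face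
`TermFamily.ne5_at_max_of_model_reach_step` with `max θ r_fb = θ`): under the same displayed binders and the ONE extra inequality
`ω + (64τe^{−5σ})·Λhist∕(s − Λhist·ρ₀′)·c < θ` (skeleton §0: the ε₁-type restriction under which route P2 delivers the input rate with no
loss), `∃ C₅, NE5 (outA_KP 𝔖.toSlots E₀ cB) (outB_KP 𝔖.toSlots E₀ cB) W κ θ C₅`.  NOT a proof of NE5. -/
theorem ne5_at_rate_kp_termModel (hT : (assembly 𝔖.toSlots).TransportReads Set.univ) {W : Set (ℕ → ℝ)}
    {m : (ℕ → ℝ) → R.carriers.BgB → R.carriers.Dom → ℝ}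
    {A_m R_m τ σ s A₀ E₀' E₁ κ θ δ δ' c ω Λop Λhist ρ₀ ρ₀' : ℝ}
    (hA_m : 0 ≤ A_m) (hτ : 0 ≤ τ) (hσ : 0 ≤ σ) (hs0 : 0 ≤ s)
    (hm0 : ∀ (g : ℕ → ℝ) (U : R.carriers.BgB) (Z : R.carriers.Dom), 0 ≤ m g U Z)
    (hm : ∀ g ∈ W, ∀ (U : R.carriers.BgB) (k : ℕ), ∀ Z ∈ R.domAt k, m g U Z ≤ A_m * Real.exp (-(R_m * R.carriers.d Z)))
    (hrate : 64 * Real.log 162 + σ + τ * 64 ≤ R_m)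
    (hsmall : (1 + s) * A_m * Real.exp (σ * 5 + τ * 64) * B12TreeDecay.K₀ (4 * 2 ^ 4) (2 * 4) * 9 ≤ τ) (hσκ : κ + 1 ≤ σ)
    (hwf : (termFamily 𝔖 E₀ cB 𝔡).WellFormed W)
    (hsum : ∀ g ∈ W, ∀ (U : R.carriers.BgB) (X : R.carriers.Dom), ∀ Z ∈ (domainGeometry R).level (R.carriers.scale X),
      ∑ ℓ ∈ innerLabels (b13InnerData R) (R.carriers.scale X) Z, (termFamily 𝔖 E₀ cB 𝔡).G Λop Λhist ρ₀ g U X Z ℓ ≤ m g U Z)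
    (hρ₁ : ρ₀ ≤ 1)
    (hRef : ∀ g ∈ W, ∀ (U : R.carriers.BgB) (X : R.carriers.Dom),
      ∀ Z ∈ (domainGeometry R).level (R.carriers.scale X), ∀ ℓ ∈ innerLabels (b13InnerData R) (R.carriers.scale X) Z,
        (termData 𝔖.F 𝔖.G 𝔖.rHist 𝔖.core Z ℓ).RefAt (𝔡 Z ℓ) (inputB_KP 𝔖.toSlots E₀ cB g U X))
    (hdA : DecayBound (outA_KP 𝔖.toSlots E₀ cB) W A₀ κ) (hdB : DecayBound (outB_KP 𝔖.toSlots E₀ cB) W E₀' κ)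
    (hop : (step 𝔖.toSlots E₀ cB).OperatorRate W δ θ) (hins : (step 𝔖.toSlots E₀ cB).InsertionRate W κ E₀' δ' θ)
    (hunit : (step 𝔖.toSlots E₀ cB).InsScaleBound W κ E₁ c ω)
    (hE₁ : 0 < E₁) (hΛop : 0 < Λop) (hΛhist : 0 < Λhist) (hρ : max (Λhist / Λop) 1 * ρ₀' ≤ ρ₀)
    (hs : Λhist * ρ₀' < s) (hδ : 0 ≤ δ) (hδ' : 0 ≤ δ') (hθ : 0 ≤ θ) (hθ1 : θ < 1)
    (hc : 0 ≤ c) (hω : 0 < ω) (hω1 : ω < 1) (hreach : c * (A₀ + E₀') / (1 - ω) < ρ₀')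
    (hfb : ω + (τ * 64 * Real.exp (-(σ * 5))) * Λhist / (s - Λhist * ρ₀') * c < θ) :
    ∃ C₅, NE5 (outA_KP 𝔖.toSlots E₀ cB) (outB_KP 𝔖.toSlots E₀ cB) W κ θ C₅ := by
  obtain ⟨haffN, hblindN, hhomN, -⟩ := structure_binders 𝔖.toSlots E₀ cB W
  have h := ActivityStepJunction.TermFamily.ne5_at_max_of_model_reach_step (termFamily 𝔖 E₀ cB 𝔡)
    (readsStep_termFamily 𝔖 E₀ cB 𝔡) hwf hsum hρ₁
    (represents_kp 𝔖.toSlots E₀ cB hT) (realizes_termFamily 𝔖 E₀ cB 𝔡 W) (inBase_termFamily 𝔖 E₀ cB 𝔡 hRef)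
    (kpInflated_b13 (rhoA 𝔖.toSlots E₀ cB) (rhoB 𝔖.toSlots E₀ cB) hA_m hτ hσ hs0 hm0 hm hrate hsmall)
    (decayExtract_b13 (rhoA 𝔖.toSlots E₀ cB) (rhoB 𝔖.toSlots E₀ cB) hσ)
    (pinBudget_b13 (rhoA 𝔖.toSlots E₀ cB) (rhoB 𝔖.toSlots E₀ cB) hτ hσκ) hdA hdB hop hins haffN hblindN hhomN hunit hE₁
    (by positivity) hΛop hΛhist hρ hs hδ hδ' hθ hθ1 hc hω hω1 hreach (ne_of_gt hfb)
  rwa [max_eq_left hfb.le] at h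

/-- [folklore] **… TRANSFERRED TO THE HOLDER's FUNCTIONALS OF RECORD** `B13StepOfRecord.outA`∕`outB` by R-IDENT
(`B13KPStepOfRecord.ne5_above_max_record_of_kp`): on a window where the two convergence binders hold at both runs' input points of the
KP recursion, the same `∃ C₅, NE5 (outA 𝔖.toSlots E₀ cB) (outB 𝔖.toSlots E₀ cB) W κ θ′ C₅`.  NOT a proof of NE5. -/
theorem ne5_above_max_record_termModel (hT : (assembly 𝔖.toSlots).TransportReads Set.univ) {W : Set (ℕ → ℝ)}
    {m : (ℕ → ℝ) → R.carriers.BgB → R.carriers.Dom → ℝ}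
    {A_m R_m τ σ s A₀ E₀' E₁ κ θ δ δ' c ω Λop Λhist ρ₀ ρ₀' : ℝ}
    (hsumA : ∀ g ∈ W, ∀ (U : R.carriers.BgB) (X : R.carriers.Dom), LevelSummable 𝔖.toSlots X (inputA_KP 𝔖.toSlots E₀ cB g U X))
    (hKA : ∀ g ∈ W, ∀ (U : R.carriers.BgB) (X : R.carriers.Dom), ClusAbsConv 𝔖.toSlots X (inputA_KP 𝔖.toSlots E₀ cB g U X))
    (hsumB : ∀ g ∈ W, ∀ (U : R.carriers.BgB) (X : R.carriers.Dom), LevelSummable 𝔖.toSlots X (inputB_KP 𝔖.toSlots E₀ cB g U X))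
    (hKB : ∀ g ∈ W, ∀ (U : R.carriers.BgB) (X : R.carriers.Dom), ClusAbsConv 𝔖.toSlots X (inputB_KP 𝔖.toSlots E₀ cB g U X))
    (hA_m : 0 ≤ A_m) (hτ : 0 ≤ τ) (hσ : 0 ≤ σ) (hs0 : 0 ≤ s)
    (hm0 : ∀ (g : ℕ → ℝ) (U : R.carriers.BgB) (Z : R.carriers.Dom), 0 ≤ m g U Z)
    (hm : ∀ g ∈ W, ∀ (U : R.carriers.BgB) (k : ℕ), ∀ Z ∈ R.domAt k, m g U Z ≤ A_m * Real.exp (-(R_m * R.carriers.d Z)))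
    (hrate : 64 * Real.log 162 + σ + τ * 64 ≤ R_m)
    (hsmall : (1 + s) * A_m * Real.exp (σ * 5 + τ * 64) * B12TreeDecay.K₀ (4 * 2 ^ 4) (2 * 4) * 9 ≤ τ) (hσκ : κ + 1 ≤ σ)
    (hwf : (termFamily 𝔖 E₀ cB 𝔡).WellFormed W)
    (hsum : ∀ g ∈ W, ∀ (U : R.carriers.BgB) (X : R.carriers.Dom), ∀ Z ∈ (domainGeometry R).level (R.carriers.scale X),
      ∑ ℓ ∈ innerLabels (b13InnerData R) (R.carriers.scale X) Z, (termFamily 𝔖 E₀ cB 𝔡).G Λop Λhist ρ₀ g U X Z ℓ ≤ m g U Z)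
    (hρ₁ : ρ₀ ≤ 1)
    (hRef : ∀ g ∈ W, ∀ (U : R.carriers.BgB) (X : R.carriers.Dom),
      ∀ Z ∈ (domainGeometry R).level (R.carriers.scale X), ∀ ℓ ∈ innerLabels (b13InnerData R) (R.carriers.scale X) Z,
        (termData 𝔖.F 𝔖.G 𝔖.rHist 𝔖.core Z ℓ).RefAt (𝔡 Z ℓ) (inputB_KP 𝔖.toSlots E₀ cB g U X))
    (hdA : DecayBound (outA_KP 𝔖.toSlots E₀ cB) W A₀ κ) (hdB : DecayBound (outB_KP 𝔖.toSlots E₀ cB) W E₀' κ)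
    (hop : (step 𝔖.toSlots E₀ cB).OperatorRate W δ θ) (hins : (step 𝔖.toSlots E₀ cB).InsertionRate W κ E₀' δ' θ)
    (hunit : (step 𝔖.toSlots E₀ cB).InsScaleBound W κ E₁ c ω)
    (hE₁ : 0 < E₁) (hΛop : 0 < Λop) (hΛhist : 0 < Λhist) (hρ : max (Λhist / Λop) 1 * ρ₀' ≤ ρ₀)
    (hs : Λhist * ρ₀' < s) (hδ : 0 ≤ δ) (hδ' : 0 ≤ δ') (hθ : 0 ≤ θ) (hθ1 : θ < 1)
    (hc : 0 ≤ c) (hω : 0 < ω) (hω1 : ω < 1) (hreach : c * (A₀ + E₀') / (1 - ω) < ρ₀')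
    {θ' : ℝ} (hθ' : max θ (ω + (τ * 64 * Real.exp (-(σ * 5))) * Λhist / (s - Λhist * ρ₀') * c) < θ') :
    ∃ C₅, NE5 (outA 𝔖.toSlots E₀ cB) (outB 𝔖.toSlots E₀ cB) W κ θ' C₅ :=
  ne5_above_max_record_of_kp 𝔖.toSlots E₀ cB hT hsumA hKA hsumB hKB
    (ne5_above_max_kp_termModel 𝔖 E₀ cB 𝔡 hT hA_m hτ hσ hs0 hm0 hm hrate hsmall hσκ hwf hsum hρ₁ hRef hdA hdB hop hins hunit hE₁
      hΛop hΛhist hρ hs hδ hδ' hθ hθ1 hc hω hω1 hreach hθ')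

end Record

end Summit.QuantumFields.BalabanUV.T4Continuum.B13KPStepTermModel

end
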